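import Summits.PneNP.PneNP.Theses.KarlinRubin
import Summits.PneNP.PneNP.Theorems.OneSliceSliceMonotonization

/-!
# Crux `MonotoneSuffices` (stmt-PneNP-18026, route KarlinRubin) — line `slice-transport`

The crux ("computational Karlin–Rubin"): for every `δ ∈ (0, 1/2)` there is `a : ℕ` such that for
every size budget `s`, if SOME family of fan-in-2 circuits of size `≤ s n` strongly detects the planted
`⌈n^{1/2-δ}⌉`-clique at density `1/2` (type-I + type-II error `→ 0`), then some MONOTONE family
(`{∧₂, ∨₂, 0, 1}`) of size `≤ (s n + n)^a` does too.

THE LINE (strategist, 2026-08-17). The only theorem-grade "monotone suffices" is Berkowitz's: on ONE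
Hamming slice `|x| = m` negation is powerless (a `B₂`-circuit is simulated by an `{∧₂, ∨₂}`-circuit with
polynomial overhead, PROVED in the tree as `Summit.PneNP.PneNP.Theses.OneSlice.SliceMonotonization` /
`Summit.PneNP.PneNP.Theorems.sliceMonotonization_proof`). The planted pair is not supported on one
slice, but it is TRANSPORTABLE to one: deleting the first `d` present edges in a fixed random order, with
`d` drawn from the law of `m⋆ - Bin(C(n,2), 1/2)`, maps `G(n, 1/2)` conditioned on `|x| = m⋆` EXACTLY to
`G(n, 1/2)` conditioned on `|x| ≤ m⋆`, and maps the planted law conditioned on `|x| = m⋆` to the planted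
law up to total variation `O(n^{-2δ} log n)` (a clique edge is deleted with that probability; the
slice-weight ratio `C(N, m) / (2^K C(N-K, m-K))` is `1 + o(1)` on the bulk), where
`m⋆(n) = C(n,2)/2 + n(⌊log₂ n⌋ + 1)` sits `√(log) · σ` above the bulk. Hence (averaging over the order and
`d`): an unconditional detector of size `s` yields a `B₂`-detector of size `s + n^{c₁}` that is good
CONDITIONALLY ON THE SLICE `m⋆` (`stub_transport`), hence — Berkowitz — a MONOTONE circuit of size
`c₀ (s + n^{c₁} + n^{c₀})` good conditionally on the slice `m⋆`. So every proof obligation that is not a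
theorem is concentrated in ONE monotone lower bound:

* `stub_sliceBlind` — monotone circuits need size `n^{Ω(log n)}` (here: `size^e ≥ 2^{⌊log₂ n⌋²}`
  eventually, for every slice-detecting family) to detect the planted `⌈n^{1/2-δ}⌉`-clique CONDITIONALLY
  ON THE SLICE `|x| = m⋆(n)` (uniform `m⋆`-edge graphs versus `K_A ∪` uniform completion to `m⋆` edges).
  This is the planted-clique twin of route OneSlice's `SliceTarget` (average-case monotone lower bound on
  one slice) and it is summit-strength BY THEOREMS (with `stub_transport` + Berkowitz it gives
  superpolynomial `B₂` lower bounds for planted clique, hence `NP ⊄ P/poly`); its technique class is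
  restricted-model lower bounds (approximation / closure / quasi-sunflowers: `RossmanMonotoneClique*`,
  `MonotoneClosure`, `GnpPlantedLikelihoodRatio`), its catalogued barrier is
  `Literature.Barriers.PneNP.ApproximationMethodLimit` (Razborov 1989: on a slice monotone = general, so no
  LEGITIMATE-MODEL approximation argument proves it) — see the line card `Lines/slice-transport.md`.
* `stub_bruteForce` — the monotone `(3⌊log₂ n⌋ + 3)`-clique DNF (size `2^{O(log² n)}`) strongly detects
  for every `δ < 1/2` (type I `→ 0` by the proved first-moment item `ErdosRenyiNoLargeClique`, type II `= 0`
  eventually). It calibrates the scale: once the general detector is forced to size `n^{Ω(log n)}`, the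
  monotone brute force fits under `(s n + n)^a`.
* the composition `MonotoneSuffices_of` (PROVED below, sorry-free): the scale argument
  `2^{c₄ L²} = (2^{L²})^{c₄} ≤ (c₀ (s n + n^{c₁} + n^{c₀}))^{e c₄} ≤ (s n + n)^{(2c₀ + c₁ + 3) e c₄}`.

What this line does NOT claim: a distribution-specific monotone SIMULATION with the slice floated
away (the route's original bet). The strategist's analysis (STRATEGY-CENSUS.md, §Negation) records a
two-slice obstruction: no vector of monotone pseudo-complements is `≤ ¬x` on a slice above the bulk and
`≥ ¬x` on a slice below it, so Berkowitz-type substitution cannot produce one monotone circuit that is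
good on two sandwiching slices (which, by slice-monotonicity of up-set densities, is exactly what an
unconditional monotone detector obtained by substitution would have to be).

References: S. J. Berkowitz (1982) [Berkowitz1982]; L. Valiant, SIAM J. Comput. 15 (1986)
[Valiant1986]; S. Jukna, *Boolean Function Complexity* (2012), Thm. 10.1 [Jukna2012]; B. Rossman, *The
monotone complexity of k-clique on random graphs*, FOCS 2010 / SICOMP 2014 [Rossman2010]; B. Rossman,
ECCC TR16-206 (2017) (average-case syntactic vs semantic monotonicity; cited by route OneSlice)
[Rossman2017]; J. Błasiok, L. Meierhöfer, arXiv:2501.09545 (bare cliques vs `G(n,1/2)`, monotone)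
[BlasiokMeierhofer2025]; É. Tardos, Combinatorica 8 (1988) [Tardos1988]; A. Razborov, STOC 1989 /
J. Pich, comput. complex. 33 (2024) [Pich2024]; M. Jerrum (1992), L. Kučera (1995), Alon–Krivelevich–Sudakov
(1998) (planted clique) [Jerrum1992, Kucera1995, AlonKrivelevichSudakov1998].
-/

set_option linter.dupNamespace false -- `Summit.PneNP.PneNP.…` is the layout-mandated namespace

namespace Summit.PneNP.PneNP.Cruxes.MonotoneSuffices.SliceTransport

open Literature.Computability.Complexity Literature.Probability.RandomGraphs.PlantedClique Filter Finset

open scoped Classical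

/-! ### The interface -/

/-- The transport slice `m⋆(n) = C(n,2)/2 + n (⌊log₂ n⌋ + 1)`: `Θ(√(log n))` standard deviations above
the bulk of `Bin(C(n,2), 1/2)` (so `Pr[|G(n,1/2)| > m⋆] → 0` by Chebyshev) yet only `n^{1+o(1)}` above
the mean (so transporting to it deletes a planted-clique edge with probability `O(n^{-2δ} log n) → 0` for
every `δ > 0`). -/
def mStar (n : ℕ) : ℕ := n.choose 2 / 2 + n * (Nat.log 2 n + 1)

/-- The planted clique size of the crux, `k_δ(n) = ⌈n^{1/2-δ}⌉`. -/
noncomputable def kOf (δ : ℝ) (n : ℕ) : ℕ := ⌈(n : ℝ) ^ (1 / 2 - δ)⌉₊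

/-- The edge count `|x|` of an edge vector. -/
def eCount {n : ℕ} (x : EdgeVec n) : ℕ := (univ.filter fun e => x e = true).card

/-- Slice type-I error of a test `f` at slice `m`: the fraction of the graphs with exactly `m` edges that
`f` accepts (`G(n,1/2)` conditioned on `|x| = m` is uniform on the slice). Junk `0` on an empty slice. -/
noncomputable def sliceErrI (n m : ℕ) (f : EdgeVec n → Bool) : ℝ :=
  ((univ.filter fun x : EdgeVec n => eCount x = m ∧ f x = true).card : ℝ) /
    ((univ.filter fun x : EdgeVec n => eCount x = m).card : ℝ)

/-- Slice type-II error of `f` at clique size `k` and slice `m`: the fraction of the pairs `(A, x)`,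
`A` a planted set (`kSubsets n k`), `K_A ⊆ x` (`plant A x = x`), `|x| = m`, that `f` rejects. The planted
joint law `plantedCliqueJoint n k` gives all such pairs the same weight, so this IS the planted law
conditioned on `|x| = m`. Junk `0` on an empty slice. -/
noncomputable def sliceErrII (n k m : ℕ) (f : EdgeVec n → Bool) : ℝ :=
  (((kSubsets n k ×ˢ (univ : Finset (EdgeVec n))).filter fun p =>
      plant p.1 p.2 = p.2 ∧ eCount p.2 = m ∧ f p.2 = false).card : ℝ) /
    (((kSubsets n k ×ˢ (univ : Finset (EdgeVec n))).filter fun p =>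
      plant p.1 p.2 = p.2 ∧ eCount p.2 = m).card : ℝ)

/-- The crux's (unconditional) error sum of a circuit family at clique size `k`: type I under `G(n,1/2)`
plus type II under the planted law (`ℝ≥0∞`, verbatim the crux's expression). -/
noncomputable def errSum (k : ℕ → ℕ) (C : (n : ℕ) → Circuit ((⊤ : SimpleGraph (Fin n)).edgeSet)) (n : ℕ) :
    ENNReal :=
  (erdosRenyiHalf n).toOuterMeasure {x | (C n).eval x = true} +
    (plantedCliqueDist n (k n)).toOuterMeasure {x | (C n).eval x = false}

/-- The slice error sum of a family at the transport slice `m⋆`. -/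
noncomputable def sliceErrSum (δ : ℝ) (C : (n : ℕ) → Circuit ((⊤ : SimpleGraph (Fin n)).edgeSet))
    (n : ℕ) : ℝ :=
  sliceErrI n (mStar n) (C n).eval + sliceErrII n (kOf δ n) (mStar n) (C n).eval

/-- `TransportSpec`: unconditional strong detectors transport to slice-`m⋆` strong detectors with additive
polynomial size overhead (the content of `stub_transport`). -/
def TransportSpec : Prop :=
  ∀ δ : ℝ, 0 < δ → δ < 1 / 2 → ∃ c₁ : ℕ,
    ∀ C : (n : ℕ) → Circuit ((⊤ : SimpleGraph (Fin n)).edgeSet),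
      (∀ᶠ n : ℕ in atTop, (C n).IsOver B2) → Tendsto (errSum (kOf δ) C) atTop (nhds 0) →
        ∃ C₁ : (n : ℕ) → Circuit ((⊤ : SimpleGraph (Fin n)).edgeSet),
          (∀ᶠ n : ℕ in atTop, (C₁ n).IsOver B2 ∧ (C₁ n).size ≤ (C n).size + n ^ c₁) ∧
            Tendsto (sliceErrSum δ C₁) atTop (nhds 0)

/-- `SliceBlindSpec`: quantitative monotone lower bound for slice-conditional detection (the content of
`stub_sliceBlind`): every monotone family that strongly detects on the slice `m⋆` has size with
`size^e ≥ 2^{⌊log₂ n⌋²}` eventually, i.e. size `≥ n^{(1/e - o(1)) log₂ n}`. -/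
def SliceBlindSpec : Prop :=
  ∀ δ : ℝ, 0 < δ → δ < 1 / 2 → ∃ e : ℕ, 0 < e ∧
    ∀ M : (n : ℕ) → Circuit ((⊤ : SimpleGraph (Fin n)).edgeSet),
      (∀ᶠ n : ℕ in atTop, (M n).IsOver monotoneBasis) → Tendsto (sliceErrSum δ M) atTop (nhds 0) →
        ∀ᶠ n : ℕ in atTop, 2 ^ (Nat.log 2 n ^ 2) ≤ (M n).size ^ e

/-- `BruteForceSpec`: a monotone family of size `2^{O(log² n)}` strongly detects for every `δ < 1/2`
(the content of `stub_bruteForce`: the `(3⌊log₂ n⌋+3)`-clique DNF). -/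
def BruteForceSpec : Prop :=
  ∃ c₄ : ℕ, ∃ M : (n : ℕ) → Circuit ((⊤ : SimpleGraph (Fin n)).edgeSet),
    (∀ᶠ n : ℕ in atTop, (M n).IsOver monotoneBasis01 ∧ (M n).size ≤ 2 ^ (c₄ * Nat.log 2 n ^ 2)) ∧
      ∀ δ : ℝ, 0 < δ → δ < 1 / 2 → Tendsto (errSum (kOf δ) M) atTop (nhds 0)

/-! ### Registered stubs

Each stub is stated in LIBRARY VOCABULARY ONLY (the interface `def`s above are unfolded), so that a
stub-worker's Theorems file can state it verbatim; `…_of_stub` below folds them back by `rfl`. -/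

/-- **stub_transport** (slice transport by random deletion; NEW, size L). For `δ ∈ (0,1/2)` there is `c₁`
such that every `B₂`-family `C` with unconditional error sum `→ 0` at clique size `⌈n^{1/2-δ}⌉` yields a
`B₂`-family `C₁`, `|C₁ n| ≤ |C n| + n^{c₁}`, whose SLICE error sum at `m⋆(n) = C(n,2)/2 + n(⌊log₂ n⌋+1)`
tends to `0`. Construction: `C₁ n = C n ∘ del_{P,d}` where `del_{P,d}` switches off the first `d` present
edges of `x` in the fixed order `P` (prefix counters + comparators, `O(N log N)` gates over `B₂`);
`(P, d)` is fixed by averaging from `P` uniform and `d ∼ λ`, `λ(d) ∝ Bin(C(n,2),1/2)(m⋆ - d)`.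
Correctness: (null) `x` uniform on slice `m⋆` ↦ uniform on slice `m⋆ - d`, so the `λ`-mixture is
`G(n,1/2)` conditioned on `|x| ≤ m⋆`, and `Pr[Bin > m⋆] ≤ C(n,2)/(4 n²(⌊log₂ n⌋+1)²) → 0` (Chebyshev);
(planted) a pair `(A, x)` uniform with `K_A ⊆ x`, `|x| = m⋆` ↦ with probability
`≥ 1 - E[d]·C(k,2)/(m⋆ - d) = 1 - O(n^{-2δ} log n)` no clique edge is deleted and then the image is
uniform over pairs on slice `m⋆ - d`; the slice weights `C(N,m)/(2^K C(N-K, m-K)) =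
∏_{i<K} (N-i)/(2(m-i)) ∈ [1 - o(1), 1 + o(1)]` for `|m - N/2| ≤ n(⌊log₂ n⌋+1)`, `K = C(k,2) ≤ n^{1-2δ}`.
So `E_{P,d}[slice error sum of C ∘ del] ≤ (1 + o(1)) · errSum(C) + o(1)`. Size: L.
[cite: Jukna2012, §10.1.1 (slices)] [cite: AlonKrivelevichSudakov1998, §1 (the planted model)] -/
theorem stub_transport :
    ∀ δ : ℝ, 0 < δ → δ < 1 / 2 → ∃ c₁ : ℕ,
      ∀ C : (n : ℕ) → Circuit ((⊤ : SimpleGraph (Fin n)).edgeSet),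
        (∀ᶠ n : ℕ in atTop, (C n).IsOver B2) →
        Tendsto (fun n : ℕ =>
            (erdosRenyiHalf n).toOuterMeasure {x | (C n).eval x = true} +
              (plantedCliqueDist n ⌈(n : ℝ) ^ (1 / 2 - δ)⌉₊).toOuterMeasure {x | (C n).eval x = false})
          atTop (nhds 0) →
        ∃ C₁ : (n : ℕ) → Circuit ((⊤ : SimpleGraph (Fin n)).edgeSet),
          (∀ᶠ n : ℕ in atTop, (C₁ n).IsOver B2 ∧ (C₁ n).size ≤ (C n).size + n ^ c₁) ∧
          Tendsto (fun n : ℕ =>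
              ((univ.filter fun x : EdgeVec n =>
                    (univ.filter fun e => x e = true).card = n.choose 2 / 2 + n * (Nat.log 2 n + 1) ∧
                      (C₁ n).eval x = true).card : ℝ) /
                  ((univ.filter fun x : EdgeVec n =>
                    (univ.filter fun e => x e = true).card = n.choose 2 / 2 + n * (Nat.log 2 n + 1)).card : ℝ) +
              (((kSubsets n ⌈(n : ℝ) ^ (1 / 2 - δ)⌉₊ ×ˢ (univ : Finset (EdgeVec n))).filter fun p =>
                    plant p.1 p.2 = p.2 ∧
                      (univ.filter fun e => p.2 e = true).card = n.choose 2 / 2 + n * (Nat.log 2 n + 1) ∧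
                        (C₁ n).eval p.2 = false).card : ℝ) /
                  (((kSubsets n ⌈(n : ℝ) ^ (1 / 2 - δ)⌉₊ ×ˢ (univ : Finset (EdgeVec n))).filter fun p =>
                    plant p.1 p.2 = p.2 ∧
                      (univ.filter fun e => p.2 e = true).card =
                        n.choose 2 / 2 + n * (Nat.log 2 n + 1)).card : ℝ))
            atTop (nhds 0) := by
  sorry

/-- **stub_sliceBlind** (the HARD stub: a quantitative monotone lower bound on ONE slice). For
`δ ∈ (0,1/2)` there is `e ≥ 1` such that every family of `{∧₂, ∨₂}`-circuits whose slice error sum at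
`m⋆(n)` (uniform `m⋆`-edge graphs vs. `K_A ∪` uniform completion, `|A| = ⌈n^{1/2-δ}⌉`) tends to `0`
satisfies `|M n|^e ≥ 2^{⌊log₂ n⌋²}` for all large `n` (size `n^{Ω(log n)}`; the truth is conjecturally
`n^{Θ(δ log n)}`, attained by guess-and-verify). Intended proof target (finite form, implies this):
`∃ e η > 0, ∀ᶠ n, ∀ M` monotone with `|M|^e < 2^{⌊log₂ n⌋²}`, slice error sum `≥ η`. Why plausibly
true: it follows from the almost-everywhere strong planted-clique hypothesis for circuits (no
`n^{o(log n)}`-size `B₂` detector), because a slice-`m⋆` monotone detector pads back (add the first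
`m⋆ - |x|` absent edges in a fixed random order: exact on both laws) to an unconditional `B₂` detector of
size `+ poly(n)`. Why it is the crux of the line: with `stub_transport` + Berkowitz it implies
superpolynomial `B₂` lower bounds for planted clique (so it is at least `NP ⊄ P/poly`-hard); technique
class = average-case monotone lower bounds (Rossman's closure / quasi-sunflowers, in-tree
`RossmanMonotoneClique*`, `MonotoneClosure`, `GnpPlantedLikelihoodRatio`); barrier =
`Literature.Barriers.PneNP.ApproximationMethodLimit` (on a slice monotone ≈ general, Jukna §10.1:
"existing methods for monotone circuits do not work for slice functions"). Size: XL / open.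
[cite: Rossman2010, Thm. 1.1 and §9] [cite: Jukna2012, Thm. 10.1 and §10.1] [cite: BlasiokMeierhofer2025, Thm. 1.3–1.4] -/
theorem stub_sliceBlind :
    ∀ δ : ℝ, 0 < δ → δ < 1 / 2 → ∃ e : ℕ, 0 < e ∧
      ∀ M : (n : ℕ) → Circuit ((⊤ : SimpleGraph (Fin n)).edgeSet),
        (∀ᶠ n : ℕ in atTop, (M n).IsOver monotoneBasis) →
        Tendsto (fun n : ℕ =>
            ((univ.filter fun x : EdgeVec n =>
                  (univ.filter fun e => x e = true).card = n.choose 2 / 2 + n * (Nat.log 2 n + 1) ∧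
                    (M n).eval x = true).card : ℝ) /
                ((univ.filter fun x : EdgeVec n =>
                  (univ.filter fun e => x e = true).card = n.choose 2 / 2 + n * (Nat.log 2 n + 1)).card : ℝ) +
            (((kSubsets n ⌈(n : ℝ) ^ (1 / 2 - δ)⌉₊ ×ˢ (univ : Finset (EdgeVec n))).filter fun p =>
                  plant p.1 p.2 = p.2 ∧
                    (univ.filter fun e => p.2 e = true).card = n.choose 2 / 2 + n * (Nat.log 2 n + 1) ∧
                      (M n).eval p.2 = false).card : ℝ) /
                (((kSubsets n ⌈(n : ℝ) ^ (1 / 2 - δ)⌉₊ ×ˢ (univ : Finset (EdgeVec n))).filter fun p =>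
                  plant p.1 p.2 = p.2 ∧
                    (univ.filter fun e => p.2 e = true).card =
                      n.choose 2 / 2 + n * (Nat.log 2 n + 1)).card : ℝ))
          atTop (nhds 0) →
        ∀ᶠ n : ℕ in atTop, 2 ^ (Nat.log 2 n ^ 2) ≤ (M n).size ^ e := by
  sorry

/-- **stub_bruteForce** (monotone brute force calibrates the scale; size M). There are `c₄` and a family
`M n` of `{∧₂, ∨₂, 0, 1}`-circuits with `|M n| ≤ 2^{c₄ ⌊log₂ n⌋²}` eventually, such that for every
`δ ∈ (0,1/2)` the unconditional error sum at clique size `⌈n^{1/2-δ}⌉` tends to `0`. Construction: the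
monotone DNF `⋁_{|T| = t} ⋀_{e ⊆ T} x_e` of "`x` has a `t`-clique", `t = 3⌊log₂ n⌋ + 3`, with
`C(n,t)·(C(t,2) - 1) + C(n,t) ≤ n^t t² ≤ 2^{3(L+1)L + …} ≤ 2^{c₄ L²}` gates (`CktSize` calculus:
`cktSize_forall_comp`-type folds of `∧`/`∨`); type I `→ 0` by the PROVED first-moment item
`Summit.PneNP.PneNP.Theses.KarlinRubin.ErdosRenyiNoLargeClique` /
`plantedClique_erdosRenyiNoLargeClique_proof` (`t ≥ (2+1) log₂ n`), type II `= 0` as soon as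
`t ≤ ⌈n^{1/2-δ}⌉ ≤ n` (`mem_support_plantedCliqueJoint`), exactly as in the route's `closes`. Size: M.
[cite: Jukna2012, §1.1 (monotone DNF)] [cite: AlonKrivelevichSudakov1998, §1] [cite: Kucera1995, §1] -/
theorem stub_bruteForce :
    ∃ c₄ : ℕ, ∃ M : (n : ℕ) → Circuit ((⊤ : SimpleGraph (Fin n)).edgeSet),
      (∀ᶠ n : ℕ in atTop, (M n).IsOver monotoneBasis01 ∧ (M n).size ≤ 2 ^ (c₄ * Nat.log 2 n ^ 2)) ∧
      ∀ δ : ℝ, 0 < δ → δ < 1 / 2 →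
        Tendsto (fun n : ℕ =>
            (erdosRenyiHalf n).toOuterMeasure {x | (M n).eval x = true} +
              (plantedCliqueDist n ⌈(n : ℝ) ^ (1 / 2 - δ)⌉₊).toOuterMeasure {x | (M n).eval x = false})
          atTop (nhds 0) := by
  sorry

/-! ### Bridging the stubs to the interface (definitional unfolding) -/

/-- `TransportSpec` from its stub. -/
theorem transportSpec_of_stub : TransportSpec := stub_transport

/-- `SliceBlindSpec` from its stub. -/
theorem sliceBlindSpec_of_stub : SliceBlindSpec := stub_sliceBlind

/-- `BruteForceSpec` from its stub. -/
theorem bruteForceSpec_of_stub : BruteForceSpec := stub_bruteForce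

/-! ### Elementary lemmas for the composition -/

/-- `4 L + 6 ≤ 2^L` for `L ≥ 5`. -/
theorem four_mul_add_six_le_two_pow {L : ℕ} (hL : 5 ≤ L) : 4 * L + 6 ≤ 2 ^ L := by
  induction L, hL using Nat.le_induction with
  | base => norm_num
  | succ L hL ih =>
    calc 4 * (L + 1) + 6 = (4 * L + 6) + 4 := by ring
      _ ≤ 2 ^ L + 2 ^ L := Nat.add_le_add ih (by
          calc 4 = 2 ^ 2 := by norm_num
            _ ≤ 2 ^ L := Nat.pow_le_pow_right (by norm_num) (by omega))
      _ = 2 ^ (L + 1) := by ring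

/-- `2 · C(n,2) = n (n-1)`. -/
theorem two_mul_choose_two (n : ℕ) : 2 * n.choose 2 = n * (n - 1) := by
  rw [Nat.choose_two_right, mul_comm 2, Nat.div_mul_cancel (Nat.even_mul_pred_self n).two_dvd]

/-- The transport slice is a proper, nonzero slice for all large `n`. -/
theorem eventually_mStar : ∀ᶠ n : ℕ in atTop, 0 < mStar n ∧ mStar n < n.choose 2 := by
  filter_upwards [eventually_ge_atTop 32] with n hn
  have hn0 : n ≠ 0 := by omega
  have hL : 5 ≤ Nat.log 2 n := Nat.le_log_of_pow_le (by norm_num) (by simpa using hn)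
  have hpow : 2 ^ Nat.log 2 n ≤ n := Nat.pow_log_le_self 2 hn0
  have h46 : 4 * Nat.log 2 n + 6 ≤ n := (four_mul_add_six_le_two_pow hL).trans hpow
  refine ⟨?_, ?_⟩
  · unfold mStar
    have : 0 < n * (Nat.log 2 n + 1) := Nat.mul_pos (by omega) (Nat.succ_pos _)
    omega
  · -- `2 m⋆ ≤ C(n,2) + 2 n (L+1) < 2 C(n,2)` since `4 n (L+1) < n (n-1) = 2 C(n,2)`
    have h2 := two_mul_choose_two n
    have hdiv : 2 * (n.choose 2 / 2) ≤ n.choose 2 := Nat.mul_div_le (n.choose 2) 2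
    have hkey : 4 * (n * (Nat.log 2 n + 1)) < n * (n - 1) := by
      have h1 : 4 * (Nat.log 2 n + 1) < n - 1 := by omega
      calc 4 * (n * (Nat.log 2 n + 1)) = n * (4 * (Nat.log 2 n + 1)) := by ring
        _ < n * (n - 1) := Nat.mul_lt_mul_of_pos_left h1 (by omega)
    unfold mStar
    omega

/-- Polynomial absorption: `c₀ ((q - n) + n^{c₁} + n^{c₀}) ≤ q^{2c₀ + c₁ + 3}` whenever `n ≤ q`, `2 ≤ q`
(used with `q = s n + n`). -/
theorem poly_absorb (c₀ c₁ s n : ℕ) (hn : 2 ≤ n) :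
    c₀ * ((s + n ^ c₁) + n ^ c₀) ≤ (s + n) ^ (2 * c₀ + c₁ + 3) := by
  set q := s + n with hq
  have hq2 : 2 ≤ q := le_add_left hn
  have hq1 : 1 ≤ q := by omega
  set b := c₀ + c₁ + 1 with hb
  have hs : s ≤ q ^ b := by
    calc s ≤ q := Nat.le_add_right s n
      _ = q ^ 1 := (pow_one q).symm
      _ ≤ q ^ b := Nat.pow_le_pow_right hq1 (by omega)
  have hn1 : n ^ c₁ ≤ q ^ b :=
    (Nat.pow_le_pow_left (Nat.le_add_left n s) c₁).trans (Nat.pow_le_pow_right hq1 (by omega))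
  have hn0 : n ^ c₀ ≤ q ^ b :=
    (Nat.pow_le_pow_left (Nat.le_add_left n s) c₀).trans (Nat.pow_le_pow_right hq1 (by omega))
  have hsum : (s + n ^ c₁) + n ^ c₀ ≤ 3 * q ^ b := by omega
  have hc₀ : 3 * c₀ ≤ q ^ (c₀ + 2) := by
    have h1 : c₀ < 2 ^ c₀ := Nat.lt_two_pow_self
    calc 3 * c₀ ≤ 4 * 2 ^ c₀ := by omega
      _ = 2 ^ (c₀ + 2) := by ring
      _ ≤ q ^ (c₀ + 2) := Nat.pow_le_pow_left hq2 _
  calc c₀ * ((s + n ^ c₁) + n ^ c₀) ≤ c₀ * (3 * q ^ b) := Nat.mul_le_mul_left _ hsum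
    _ = (3 * c₀) * q ^ b := by ring
    _ ≤ q ^ (c₀ + 2) * q ^ b := Nat.mul_le_mul_right _ hc₀
    _ = q ^ (2 * c₀ + c₁ + 3) := by rw [← pow_add]; congr 1; omega

/-- Slice errors depend only on the values of the test ON the slice (type I). -/
theorem sliceErrI_congr {n m : ℕ} {f g : EdgeVec n → Bool} (h : ∀ x, eCount x = m → f x = g x) :
    sliceErrI n m f = sliceErrI n m g := by
  unfold sliceErrI
  congr 3
  exact filter_congr fun x _ => by
    constructor
    · rintro ⟨hx, hf⟩; exact ⟨hx, (h x hx) ▸ hf⟩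
    · rintro ⟨hx, hg⟩; exact ⟨hx, (h x hx).symm ▸ hg⟩

/-- Slice errors depend only on the values of the test ON the slice (type II). -/
theorem sliceErrII_congr {n k m : ℕ} {f g : EdgeVec n → Bool} (h : ∀ x, eCount x = m → f x = g x) :
    sliceErrII n k m f = sliceErrII n k m g := by
  unfold sliceErrII
  congr 3
  exact filter_congr fun p _ => by
    constructor
    · rintro ⟨hp, hx, hf⟩; exact ⟨hp, hx, (h p.2 hx) ▸ hf⟩
    · rintro ⟨hp, hx, hg⟩; exact ⟨hp, hx, (h p.2 hx).symm ▸ hg⟩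

/-! ### The proved composition -/

/-- **The composition with explicit hypotheses** (kernel-checked, no `sorry`; conclusion = the BODY of
`KarlinRubin.MonotoneSuffices` verbatim): transport, Berkowitz on the slice `m⋆` (route OneSlice's PROVED
item `SliceMonotonization`, taken as a hypothesis here and discharged by
`Summit.PneNP.PneNP.Theorems.sliceMonotonization_proof` below), the slice lower bound and the brute-force
calibration give `MonotoneSuffices` by the scale argument. -/
theorem monotoneSuffices_of_specs (hT : TransportSpec) (hB : SliceBlindSpec) (hU : BruteForceSpec)
    (hBerk : Summit.PneNP.PneNP.Theses.OneSlice.SliceMonotonization) :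
    -- the BODY of `KarlinRubin.MonotoneSuffices`, verbatim (the skeleton theorem below restates it by name)
    ∀ δ : ℝ, 0 < δ → δ < 1 / 2 → ∃ a : ℕ, ∀ s : ℕ → ℕ, (∃ C : (n : ℕ) → Literature.Computability.Complexity.Circuit ((⊤ : SimpleGraph (Fin n)).edgeSet), (∀ᶠ n : ℕ in Filter.atTop, (C n).IsOver Literature.Computability.Complexity.B2 ∧ (C n).size ≤ s n) ∧ Filter.Tendsto (fun n : ℕ => (Literature.Probability.RandomGraphs.PlantedClique.erdosRenyiHalf n).toOuterMeasure {x | (C n).eval x = true} + (Literature.Probability.RandomGraphs.PlantedClique.plantedCliqueDist n ⌈(n : ℝ) ^ (1 / 2 - δ)⌉₊).toOuterMeasure {x | (C n).eval x = false}) Filter.atTop (nhds 0)) → ∃ C' : (n : ℕ) → Literature.Computability.Complexity.Circuit ((⊤ : SimpleGraph (Fin n)).edgeSet), (∀ᶠ n : ℕ in Filter.atTop, (C' n).IsOver Literature.Computability.Complexity.monotoneBasis01 ∧ (C' n).size ≤ (s n + n) ^ a) ∧ Filter.Tendsto (fun n : ℕ => (Literature.Probability.RandomGraphs.PlantedClique.erdosRenyiHalf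 n).toOuterMeasure {x | (C' n).eval x = true} + (Literature.Probability.RandomGraphs.PlantedClique.plantedCliqueDist n ⌈(n : ℝ) ^ (1 / 2 - δ)⌉₊).toOuterMeasure {x | (C' n).eval x = false}) Filter.atTop (nhds 0) := by
  intro δ hδ hδ'
  obtain ⟨e, _he, hblind⟩ := hB δ hδ hδ'
  obtain ⟨c₁, htrans⟩ := hT δ hδ hδ'
  obtain ⟨c₀, hberk⟩ := hBerk
  obtain ⟨c₄, M₄, hM₄, hM₄err⟩ := hU
  refine ⟨(2 * c₀ + c₁ + 3) * (e * c₄), fun s hyp => ?_⟩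
  obtain ⟨C, hC, hCerr⟩ := hyp
  -- (1) transport the unconditional detector to the slice `m⋆`
  obtain ⟨C₁, hC₁, hC₁err⟩ := htrans C (hC.mono fun n h => h.1) hCerr
  -- (2) Berkowitz on the slice, pointwise in `n` (junk off the eventual range)
  let P : ℕ → Prop := fun n => (C₁ n).IsOver B2 ∧ 0 < mStar n ∧ mStar n < n.choose 2
  let M₁ : (n : ℕ) → Circuit ((⊤ : SimpleGraph (Fin n)).edgeSet) := fun n =>
    if h : P n then (hberk n (mStar n) (C₁ n) h.1 h.2.1 h.2.2).choose else C₁ n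
  have hM₁ : ∀ᶠ n : ℕ in atTop, (M₁ n).IsOver monotoneBasis ∧
      (M₁ n).size ≤ c₀ * ((C₁ n).size + n ^ c₀) ∧
        ∀ x : EdgeVec n, eCount x = mStar n → (M₁ n).eval x = (C₁ n).eval x := by
    filter_upwards [hC₁, eventually_mStar] with n h1 h2
    have hP : P n := ⟨h1.1, h2⟩
    have hM : M₁ n = (hberk n (mStar n) (C₁ n) hP.1 hP.2.1 hP.2.2).choose := dif_pos hP
    rw [hM]
    exact (hberk n (mStar n) (C₁ n) hP.1 hP.2.1 hP.2.2).choose_spec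
  -- (3) the monotone circuit has the same slice errors, hence slice-detects
  have hM₁err : Tendsto (sliceErrSum δ M₁) atTop (nhds 0) := by
    refine (hC₁err).congr' ?_
    filter_upwards [hM₁] with n hn
    show sliceErrI n (mStar n) (C₁ n).eval + sliceErrII n (kOf δ n) (mStar n) (C₁ n).eval =
      sliceErrI n (mStar n) (M₁ n).eval + sliceErrII n (kOf δ n) (mStar n) (M₁ n).eval
    rw [sliceErrI_congr (fun x hx => (hn.2.2 x hx).symm), sliceErrII_congr (fun x hx => (hn.2.2 x hx).symm)]
  -- (4) so it is large, eventually
  have hbig : ∀ᶠ n : ℕ in atTop, 2 ^ (Nat.log 2 n ^ 2) ≤ (M₁ n).size ^ e :=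
    hblind M₁ (hM₁.mono fun n h => h.1) hM₁err
  -- (5) hence the budget `(s n + n)^a` covers the monotone brute force
  refine ⟨M₄, ?_, hM₄err δ hδ hδ'⟩
  filter_upwards [hM₄, hbig, hM₁, hC₁, hC, eventually_ge_atTop 2] with n h4 hb h1 hc1 hc hn2
  refine ⟨h4.1, h4.2.trans ?_⟩
  have hsize : (M₁ n).size ≤ c₀ * ((s n + n ^ c₁) + n ^ c₀) :=
    h1.2.1.trans (Nat.mul_le_mul_left _ (Nat.add_le_add_right (hc1.2.trans (Nat.add_le_add_right hc.2 _)) _))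
  have hchain : 2 ^ (Nat.log 2 n ^ 2) ≤ ((s n + n) ^ (2 * c₀ + c₁ + 3)) ^ e :=
    hb.trans ((Nat.pow_le_pow_left hsize e).trans (Nat.pow_le_pow_left (poly_absorb c₀ c₁ (s n) n hn2) e))
  calc 2 ^ (c₄ * Nat.log 2 n ^ 2) = (2 ^ (Nat.log 2 n ^ 2)) ^ c₄ := by rw [← pow_mul, mul_comm]
    _ ≤ (((s n + n) ^ (2 * c₀ + c₁ + 3)) ^ e) ^ c₄ := Nat.pow_le_pow_left hchain c₄
    _ = (s n + n) ^ ((2 * c₀ + c₁ + 3) * (e * c₄)) := by rw [← pow_mul, ← pow_mul]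

/-- **THE SKELETON THEOREM `MonotoneSuffices_of`.** The crux
`Summit.PneNP.PneNP.Theses.KarlinRubin.MonotoneSuffices`, concluded BY NAME from the three declared stubs
and the PROVED tree theorem `Summit.PneNP.PneNP.Theorems.sliceMonotonization_proof` (Berkowitz on a
slice, route OneSlice's item `SliceMonotonization`) through the sorry-free composition
`monotoneSuffices_of_specs`. -/
theorem MonotoneSuffices_of : Summit.PneNP.PneNP.Theses.KarlinRubin.MonotoneSuffices :=
  monotoneSuffices_of_specs transportSpec_of_stub sliceBlindSpec_of_stub bruteForceSpec_of_stub
    Summit.PneNP.PneNP.Theorems.sliceMonotonization_proof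

end Summit.PneNP.PneNP.Cruxes.MonotoneSuffices.SliceTransport
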